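import Summits.QuantumFields.YangMills.Theorems.BalabanUVNodesN19UniformMomentSummabilityThreshold

/-!
# YM-DAG node N19 (= NE7 proper) — THE LAW-SUMMABILITY THRESHOLD OF THE UNIFORM-MOMENT CURRENCY, II:
# the lower half (the half-scale arc sequence at the level of the budget), the EXACT threshold for antitone closeness, and the instances

Cell `pub-ymgap`, HUMAN RULING D-0062 (Track A) ∕ D-0149 (work-bound push), R141 (C) wider-strategy seat `pub-ymgap-dag-n19-e` (strategy s3 =
ALTERNATIVE CURRENCY), generation g23, module 2 (lineage module 79).  Route `Summits/QuantumFields/YangMills/Theses/BalabanUVNodes.lean` rev 25,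
cluster item K3⁷ «SpineGivenEndpointR13SepCoPH» (stmt-QuantumFields-20544); filed `--supports` that item `--as helper` (it proves no registered
stub).  COUNT-NEUTRAL: [folklore] over Mathlib (`Nat.find`, `Real.posLog`, `Summable.even_add_odd`) + module 78 `…N19UniformMomentSummabilityThreshold`
BY NAME (`exists_halfScale_chebyshevArc_laws`, `summable_lawIncrements_of_uniformMoments`, the rate lemmas); TOY laws; no scheme object, no Theses
import; NOT a discharge claim.

THE RESULT.  §1 ★★ `exists_uniformMoments_not_summable_lawIncrements` — THE LOWER HALF: for every ANTITONE `r > 0` with `Σ_K 1∕(1 + log⁺ r_K⁻¹) = ∞`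
there are probability laws `λ_K` on `[−1,1]` whose moments move by at most `r_K` at step `K` UNIFORMLY IN THE ORDER (`|∫x^j dλ_{K+1} − ∫x^j dλ_K| ≤ r_K`
for every `j`) and continuous `1`-Lipschitz `1`-bounded tests `g_K` with NON-summable increments `|∫g_K dλ_{K+1} − ∫g_K dλ_K|`.  THE SEQUENCE is module
75's chain run on module 78's half-scale arc laws: `λ_{2i} = P'_{n_i}`, `λ_{2i+1} = Q'_{n_i}` at THE LEVEL OF THE BUDGET `n_i = 3 + J_i`, `J_i` the least `j`
with `2b_j ≤ r_{2i+1}`, `b_j = 2(½)^{3+j}` the distance of every moment of a level-`(3+j)` law to the common base (`Nat.find`; levels non-decreasing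
because `r` is antitone): the swap `P' ↔ Q'` at step `2i` costs `≤ 2b_{J_i} ≤ r_{2i+1} ≤ r_{2i}`, the cross move `Q'_{n_i} → P'_{n_{i+1}}` at step `2i+1`
costs `≤ b_{J_i} + b_{J_{i+1}} ≤ 2b_{J_i} ≤ r_{2i+1}`, and the swap is paid EXACTLY `1∕(4n_i)`.  THE INVERSION is one line (no Stirling, unlike module 75):
minimality of `J_i = m+1` gives `r_{2i+1} < 2b_m = (½)^{m+1}`, so `log⁺ r_{2i+1}⁻¹ ≥ (m+1)log 2 ≥ (m+1)∕2` and `(1∕16)∕(1 + log⁺ r_{2i+1}⁻¹) ≤ 1∕(4n_i)`;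
hence summable increments ⇒ odd rates summable ⇒ (antitone) even rates summable ⇒ all rates summable — contradiction.  §2 ★★
`summable_lawIncrements_iff_summable_invLogRate` — THE EXACT THRESHOLD for antitone `r > 0`: `Σ_K 1∕(1 + log⁺ r_K⁻¹) < ∞` IFF every sequence of
probability laws on `[−1,1]` with `r`-uniform moment matching has summable increments along every continuous `1`-Lipschitz `1`-bounded test sequence
(⇒ module 78; ⇐ §1).  §3 INSTANCES: ★ `not_summable_invLogRate_geometric` — for EVERY `C, θ` the rates of `Cθ^K` are not summable
(`log⁺(Cθ^K)⁻¹ ≤ log⁺C⁻¹ + K log⁺θ⁻¹`, harmonic minorant), so ★★ `exists_uniformMoments_geometric_not_summable_lawIncrements`: even UNIFORM moment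
matching at the programme's geometric remainders admits laws with non-summable bounded-Lipschitz increments; ★ `summable_invLogRate_expNegSq`: the rates
of `e^{−(K+1)²}` are summable (`log⁺ = (K+1)²`).  READING (with g22's modules 74–76): the window currency's threshold is `Σ log(e+L_K)∕(1+L_K)`, the
uniform-moment currency's is `Σ 1∕(1+L_K)` (`L_K = log⁺` of the inverse closeness) — the window's intrinsic `log log` is exactly the gap between them;
both fail for every geometric remainder and both hold at `e^{−(K+1)²}`; they separate at remainders like `e^{−K log²K}` (not filed).

HONEST FRAMING (binding).  Elementary and [folklore]; TOY laws; NO consumer in the DAG today (a structural statement about the seat's own currencies);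
nothing of Bałaban's instantiated; NE7 NOT PRINTED, NOT proved; N19 NOT discharged; count-neutral.  One finite `T⁴` programme at fixed `ε`; nothing
continuum ∕ `ℝ⁴` ∕ OS ∕ mass-gap ∕ Clay.  0 `def` ∕ 0 `sorry`.
-/

noncomputable section

open Real Finset MeasureTheory ProbabilityTheory

namespace Summit.QuantumFields.YangMills.Theorems.BalabanUVNodesN19UniformMomentSummabilityThresholdSharp

open Summit.QuantumFields.YangMills.Theorems.BalabanUVNodesN19UniformMomentSummabilityThreshold
  (invLogRate_pos invLogRate_le_one invLogRate_posLog_inv_mono summable_lawIncrements_of_uniformMoments exists_halfScale_chebyshevArc_laws)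

/-! ## §1 The lower half: the half-scale arc sequence at the level of the budget [folklore] -/

/-- ★★ **THE LOWER HALF OF THE THRESHOLD (uniform-moment currency).**  For every ANTITONE `r > 0` whose rates `1∕(1 + log⁺ r_K⁻¹)` are NOT summable
there are probability laws `λ_K` on `[−1,1]` with `|∫x^j dλ_{K+1} − ∫x^j dλ_K| ≤ r_K` for EVERY `j` and continuous tests `g_K`, `1`-Lipschitz and
`1`-bounded on `[−1,1]`, whose increments `|∫g_K dλ_{K+1} − ∫g_K dλ_K|` are NOT summable (header). [folklore] -/
theorem exists_uniformMoments_not_summable_lawIncrements {r : ℕ → ℝ} (hr : ∀ K, 0 < r K) (hanti : Antitone r)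
    (hS : ¬ Summable fun K => 1 / (1 + Real.posLog (r K)⁻¹)) :
    ∃ Λ : ℕ → Measure ℝ, (∀ K, IsProbabilityMeasure (Λ K)) ∧ (∀ K, Λ K (Set.Icc (-1 : ℝ) 1)ᶜ = 0) ∧
      (∀ K j : ℕ, |∫ x, x ^ j ∂Λ (K + 1) - ∫ x, x ^ j ∂Λ K| ≤ r K) ∧
      ∃ g : ℕ → ℝ → ℝ, (∀ K, Continuous (g K)) ∧
        (∀ (K : ℕ) (x y : ℝ), x ∈ Set.Icc (-1 : ℝ) 1 → y ∈ Set.Icc (-1 : ℝ) 1 → |g K x - g K y| ≤ 1 * |x - y|) ∧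
        (∀ (K : ℕ) (x : ℝ), x ∈ Set.Icc (-1 : ℝ) 1 → |g K x| ≤ 1) ∧
        ¬ Summable (fun K => |∫ x, g K x ∂Λ (K + 1) - ∫ x, g K x ∂Λ K|) := by
  classical
  -- the half-scale arc laws at the levels `3 + j`
  choose P Q iP iQ hPc hQc hmomEq hmom g hgc hgL hgB hpay using
    fun j : ℕ => exists_halfScale_chebyshevArc_laws (n := 3 + j) (by omega)
  haveI : ∀ j, IsProbabilityMeasure (P j) := iP
  haveI : ∀ j, IsProbabilityMeasure (Q j) := iQ
  -- the distance of every moment to the common base at level `3 + j`: `b j = 2(½)^{3+j}`, antitone in `j`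
  set b : ℕ → ℝ := fun j => 2 * (1 / 2 : ℝ) ^ (3 + j) with hbdef
  have hb_mono : ∀ {i j : ℕ}, i ≤ j → b j ≤ b i := fun {i j} hij =>
    mul_le_mul_of_nonneg_left (pow_le_pow_of_le_one (by norm_num) (by norm_num) (by omega)) (by norm_num)
  -- the step cost `2 b j` is eventually below every positive budget
  have hcost_small : ∀ x : ℝ, 0 < x → ∃ j : ℕ, 2 * b j ≤ x := by
    intro x hx
    obtain ⟨m, hm⟩ := exists_pow_lt_of_lt_one hx (by norm_num : (1 / 2 : ℝ) < 1)
    refine ⟨m, ?_⟩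
    have e : 2 * b m = (1 / 2 : ℝ) ^ m * (1 / 2) := by simp only [hbdef]; rw [pow_add]; ring
    rw [e]
    nlinarith [pow_nonneg (by norm_num : (0 : ℝ) ≤ 1 / 2) m]
  -- THE LEVEL OF THE BUDGET at the odd steps: `J i` = the least `j` whose step cost fits `r (2i+1)`
  have hex : ∀ i : ℕ, ∃ j : ℕ, 2 * b j ≤ r (2 * i + 1) := fun i => hcost_small _ (hr _)
  let J : ℕ → ℕ := fun i => Nat.find (hex i)
  have hJspec : ∀ i, 2 * b (J i) ≤ r (2 * i + 1) := fun i => Nat.find_spec (hex i)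
  have hJmin : ∀ i j, j < J i → r (2 * i + 1) < 2 * b j := fun i j hj => not_le.1 (Nat.find_min (hex i) hj)
  have hJmono : ∀ i, J i ≤ J (i + 1) := fun i => Nat.find_min' (hex i) ((hJspec (i + 1)).trans (hanti (by omega)))
  -- every step costs `≤ 2 b` in EVERY moment: same level `P_j ↔ Q_j`, or up the levels `Q_i → P_j` (`i ≤ j`)
  have hPQ : ∀ j k : ℕ, |∫ x, x ^ k ∂Q j - ∫ x, x ^ k ∂P j| ≤ 2 * b j := fun j k => by
    obtain ⟨h1, h2⟩ := hmom j k
    calc |∫ x, x ^ k ∂Q j - ∫ x, x ^ k ∂P j|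
        ≤ |∫ x, x ^ k ∂Q j - 1 / 2 * ∫ x in (-1 : ℝ)..1, (x / 2) ^ k| +
          |1 / 2 * (∫ x in (-1 : ℝ)..1, (x / 2) ^ k) - ∫ x, x ^ k ∂P j| := abs_sub_le _ _ _
      _ = |∫ x, x ^ k ∂Q j - 1 / 2 * ∫ x in (-1 : ℝ)..1, (x / 2) ^ k| +
          |∫ x, x ^ k ∂P j - 1 / 2 * ∫ x in (-1 : ℝ)..1, (x / 2) ^ k| := by rw [abs_sub_comm (1 / 2 * _) _]
      _ ≤ b j + b j := add_le_add h2 h1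
      _ = 2 * b j := by ring
  have hQP : ∀ i j k : ℕ, i ≤ j → |∫ x, x ^ k ∂P j - ∫ x, x ^ k ∂Q i| ≤ 2 * b i := fun i j k hij => by
    obtain ⟨h1, -⟩ := hmom j k
    obtain ⟨-, h2⟩ := hmom i k
    calc |∫ x, x ^ k ∂P j - ∫ x, x ^ k ∂Q i|
        ≤ |∫ x, x ^ k ∂P j - 1 / 2 * ∫ x in (-1 : ℝ)..1, (x / 2) ^ k| +
          |1 / 2 * (∫ x in (-1 : ℝ)..1, (x / 2) ^ k) - ∫ x, x ^ k ∂Q i| := abs_sub_le _ _ _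
      _ = |∫ x, x ^ k ∂P j - 1 / 2 * ∫ x in (-1 : ℝ)..1, (x / 2) ^ k| +
          |∫ x, x ^ k ∂Q i - 1 / 2 * ∫ x in (-1 : ℝ)..1, (x / 2) ^ k| := by rw [abs_sub_comm (1 / 2 * _) _]
      _ ≤ b j + b i := add_le_add h1 h2
      _ ≤ 2 * b i := by linarith [hb_mono hij]
  -- the sequence and the tests
  set Λ : ℕ → Measure ℝ := fun K => if Even K then P (J (K / 2)) else Q (J (K / 2)) with hΛ
  have hΛP : ∀ K, IsProbabilityMeasure (Λ K) := fun K => by simp only [hΛ]; split_ifs <;> infer_instance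
  have hΛc : ∀ K, Λ K (Set.Icc (-1 : ℝ) 1)ᶜ = 0 := fun K => by simp only [hΛ]; split_ifs; exacts [hPc _, hQc _]
  refine ⟨Λ, hΛP, hΛc, fun K k => ?_, fun K => g (J (K / 2)), fun K => hgc _, fun K x y hx hy => hgL _ x y hx hy,
    fun K x hx => (hgB _ x hx).trans ?_, fun hSum => ?_⟩
  · -- uniform moment matching: the step cost `2 b_{J(K∕2)}` fits the budget `r K`
    have hstep : |∫ x, x ^ k ∂Λ (K + 1) - ∫ x, x ^ k ∂Λ K| ≤ 2 * b (J (K / 2)) := by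
      rcases Nat.even_or_odd K with ⟨i, rfl⟩ | ⟨i, rfl⟩
      · have h1 : ¬Even (i + i + 1) := by rw [Nat.not_even_iff_odd]; exact ⟨i, by ring⟩
        have e1 : (i + i) / 2 = i := by omega
        have e2 : (i + i + 1) / 2 = i := by omega
        simp only [hΛ, Even.add_self i, if_true, h1, if_false, e1, e2]
        exact hPQ (J i) k
      · have h0 : ¬Even (2 * i + 1) := Nat.not_even_iff_odd.2 ⟨i, rfl⟩
        have h1 : Even (2 * i + 1 + 1) := ⟨i + 1, by ring⟩
        have e1 : (2 * i + 1) / 2 = i := by omega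
        have e2 : (2 * i + 1 + 1) / 2 = i + 1 := by omega
        simp only [hΛ, h0, if_false, h1, if_true, e1, e2]
        exact hQP (J i) (J (i + 1)) k (hJmono i)
    have hbud : 2 * b (J (K / 2)) ≤ r K := by
      rcases Nat.even_or_odd K with ⟨i, rfl⟩ | ⟨i, rfl⟩
      · have e1 : (i + i) / 2 = i := by omega
        rw [e1]
        exact (hJspec i).trans (hanti (by omega))
      · have e1 : (2 * i + 1) / 2 = i := by omega
        rw [e1]
        exact hJspec i
    exact hstep.trans hbud
  · -- `1∕(4(3 + J)) ≤ 1`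
    rw [div_le_one (by positivity)]
    have : (1 : ℝ) ≤ ((3 + J (K / 2) : ℕ) : ℝ) := by exact_mod_cast (by omega : 1 ≤ 3 + J (K / 2))
    linarith
  · -- NOT SUMMABLE.  The even steps pay exactly `1∕(4(3 + J i))`.
    have h2 : Summable (fun i : ℕ => |∫ x, g (J ((2 * i) / 2)) x ∂Λ (2 * i + 1) - ∫ x, g (J ((2 * i) / 2)) x ∂Λ (2 * i)|) :=
      hSum.comp_injective (fun a c h => by simpa using h : Function.Injective fun i : ℕ => 2 * i)
    have h3 : ∀ i : ℕ, |∫ x, g (J ((2 * i) / 2)) x ∂Λ (2 * i + 1) - ∫ x, g (J ((2 * i) / 2)) x ∂Λ (2 * i)| =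
        1 / (4 * ((3 + J i : ℕ) : ℝ)) := by
      intro i
      have h0 : ¬Even (2 * i + 1) := Nat.not_even_iff_odd.2 ⟨i, rfl⟩
      have e1 : 2 * i / 2 = i := by omega
      have e2 : (2 * i + 1) / 2 = i := by omega
      simp only [hΛ, even_two_mul, if_true, h0, if_false, e1, e2]
      rw [abs_sub_comm, hpay (J i), abs_of_pos (by positivity)]
    simp_rw [h3] at h2
    -- the rates, antitone in `K`
    set ρ : ℕ → ℝ := fun K => 1 / (1 + Real.posLog (r K)⁻¹) with hρdef
    have hρ0 : ∀ K, 0 ≤ ρ K := fun K => (invLogRate_pos _).le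
    have hρ1 : ∀ K, ρ K ≤ 1 := fun K => invLogRate_le_one _
    have hρ_anti : ∀ {K K' : ℕ}, K ≤ K' → ρ K' ≤ ρ K := fun {K K'} h => invLogRate_posLog_inv_mono (hr K') (hanti h)
    -- THE INVERSION: `(1∕16)·ρ_{2i+1} ≤ 1∕(4(3 + J i))`
    have hkey : ∀ i : ℕ, (1 / 16 : ℝ) * ρ (2 * i + 1) ≤ 1 / (4 * ((3 + J i : ℕ) : ℝ)) := by
      intro i
      by_cases hJ0 : J i = 0
      · -- bottom level: `ρ∕16 ≤ 1∕16 ≤ 1∕12`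
        have e : ((3 + J i : ℕ) : ℝ) = 3 := by rw [hJ0]; norm_num
        rw [e]
        have h1 : (1 / 16 : ℝ) * ρ (2 * i + 1) ≤ 1 / 16 := mul_le_of_le_one_right (by norm_num) (hρ1 _)
        linarith
      · -- minimality of `J i = m + 1` at `m`: `r_{2i+1} < 2 b_m = (½)^{m+1}`, so `log⁺ r⁻¹ ≥ (m+1) log 2`
        obtain ⟨m, hm⟩ := Nat.exists_eq_succ_of_ne_zero hJ0
        have hlt := hJmin i m (by omega)
        have e : 2 * b m = (1 / 2 : ℝ) ^ (m + 1) := by simp only [hbdef]; rw [pow_add, pow_succ]; ring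
        rw [e] at hlt
        have hrpos := hr (2 * i + 1)
        have hinv : (2 : ℝ) ^ (m + 1) ≤ (r (2 * i + 1))⁻¹ := by
          rw [show (2 : ℝ) ^ (m + 1) = ((1 / 2 : ℝ) ^ (m + 1))⁻¹ by rw [one_div, inv_pow, inv_inv]]
          exact (inv_anti₀ hrpos hlt.le)
        have hlog : ((m : ℝ) + 1) * Real.log 2 ≤ Real.posLog (r (2 * i + 1))⁻¹ := by
          have h1 : Real.log ((2 : ℝ) ^ (m + 1)) ≤ Real.log (r (2 * i + 1))⁻¹ := Real.log_le_log (by positivity) hinv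
          rw [Real.log_pow] at h1
          push_cast at h1
          exact h1.trans (by rw [Real.posLog_apply]; exact le_max_right _ _)
        have h5 := mul_le_mul_of_nonneg_left (show (1 / 2 : ℝ) ≤ Real.log 2 by linarith [Real.log_two_gt_d9])
          (show (0 : ℝ) ≤ (m : ℝ) + 1 by positivity)
        have hcast : ((3 + J i : ℕ) : ℝ) = m + 4 := by rw [hm]; push_cast; ring
        have hP0 := Real.posLog_nonneg (x := (r (2 * i + 1))⁻¹)
        rw [hcast, hρdef]
        rw [show (1 / 16 : ℝ) * (1 / (1 + Real.posLog (r (2 * i + 1))⁻¹)) = 1 / (16 * (1 + Real.posLog (r (2 * i + 1))⁻¹)) by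
          field_simp]
        exact one_div_le_one_div_of_le (by positivity) (by nlinarith)
    -- summability transfer: odd rates, then even rates, then all rates — contradiction
    have hodd : Summable (fun i : ℕ => ρ (2 * i + 1)) :=
      Summable.of_nonneg_of_le (fun i => hρ0 _) (fun i => (le_div_iff₀' (by norm_num : (0 : ℝ) < 1 / 16)).2 (hkey i))
        (h2.div_const (1 / 16))
    have heven : Summable (fun i : ℕ => ρ (2 * i)) := by
      have h1 : Summable (fun i : ℕ => ρ (2 * (i + 1))) :=
        Summable.of_nonneg_of_le (fun i => hρ0 _) (fun i => hρ_anti (by omega)) hodd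
      exact (summable_nat_add_iff 1).1 h1
    exact hS (Summable.even_add_odd heven hodd)

/-! ## §2 The exact threshold for antitone closeness [folklore] -/

/-- ★★ **THE EXACT LAW-SUMMABILITY THRESHOLD OF THE UNIFORM-MOMENT CURRENCY (antitone closeness).**  For an antitone `r > 0`:
`Σ_K 1∕(1 + log⁺ r_K⁻¹) < ∞` IF AND ONLY IF every sequence of probability laws `λ_K` on `[−1,1]` with `|∫x^j dλ_{K+1} − ∫x^j dλ_K| ≤ r_K` for every
`j` has summable increments `|∫g_K dλ_{K+1} − ∫g_K dλ_K|` along every sequence of continuous tests `g_K`, `1`-Lipschitz and `1`-bounded on `[−1,1]`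
(⇒ module 78 `summable_lawIncrements_of_uniformMoments`; ⇐ §1).  No `log log`: compare module 75's `Σ log(e+L_K)∕(1+L_K)` for the window. [folklore] -/
theorem summable_lawIncrements_iff_summable_invLogRate {r : ℕ → ℝ} (hr : ∀ K, 0 < r K) (hanti : Antitone r) :
    (Summable fun K => 1 / (1 + Real.posLog (r K)⁻¹)) ↔
      ∀ Λ : ℕ → Measure ℝ, (∀ K, IsProbabilityMeasure (Λ K)) → (∀ K, Λ K (Set.Icc (-1 : ℝ) 1)ᶜ = 0) →
        (∀ K j : ℕ, |∫ x, x ^ j ∂Λ (K + 1) - ∫ x, x ^ j ∂Λ K| ≤ r K) →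
        ∀ g : ℕ → ℝ → ℝ, (∀ K, Continuous (g K)) →
          (∀ (K : ℕ) (x y : ℝ), x ∈ Set.Icc (-1 : ℝ) 1 → y ∈ Set.Icc (-1 : ℝ) 1 → |g K x - g K y| ≤ 1 * |x - y|) →
          (∀ (K : ℕ) (x : ℝ), x ∈ Set.Icc (-1 : ℝ) 1 → |g K x| ≤ 1) →
          Summable fun K => |∫ x, g K x ∂Λ (K + 1) - ∫ x, g K x ∂Λ K| := by
  refine ⟨fun hS Λ hP hc hM g hg hL hB => ?_, fun h => ?_⟩
  · haveI := hP
    exact summable_lawIncrements_of_uniformMoments hc hM hS hg zero_le_one hL hB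
  · by_contra hS
    obtain ⟨Λ, hP, hc, hM, g, hgc, hL, hB, hns⟩ := exists_uniformMoments_not_summable_lawIncrements hr hanti hS
    exact hns (h Λ hP hc hM g hgc hL hB)

/-! ## §3 Instances: geometric closeness FAILS the threshold, `e^{−(K+1)²}` MEETS it [folklore] -/

/-- ★ **GEOMETRIC CLOSENESS NEVER MEETS THE THRESHOLD**: for every `C, θ` the rates `1∕(1 + log⁺(Cθ^K)⁻¹)` are NOT summable
(`log⁺(Cθ^K)⁻¹ ≤ log⁺C⁻¹ + K·log⁺θ⁻¹`, `Real.posLog_mul` ∕ `posLog_pow`; harmonic minorant `1∕((1+A+B)(K+1))`). [folklore] -/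
theorem not_summable_invLogRate_geometric (C θ : ℝ) : ¬ Summable fun K : ℕ => 1 / (1 + Real.posLog (C * θ ^ K)⁻¹) := by
  intro h
  set A : ℝ := Real.posLog C⁻¹ with hA
  set B : ℝ := Real.posLog θ⁻¹ with hB
  have hA0 : 0 ≤ A := Real.posLog_nonneg
  have hB0 : 0 ≤ B := Real.posLog_nonneg
  have hbound : ∀ K : ℕ, 1 / ((1 + A + B) * ((K + 1 : ℕ) : ℝ)) ≤ 1 / (1 + Real.posLog (C * θ ^ K)⁻¹) := by
    intro K
    have h1 : Real.posLog (C * θ ^ K)⁻¹ ≤ A + K * B := by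
      rw [mul_inv, ← inv_pow]
      calc Real.posLog (C⁻¹ * θ⁻¹ ^ K) ≤ Real.posLog C⁻¹ + Real.posLog (θ⁻¹ ^ K) := Real.posLog_mul
        _ = A + K * B := by rw [Real.posLog_pow]
    have hP0 : 0 ≤ Real.posLog (C * θ ^ K)⁻¹ := Real.posLog_nonneg
    refine one_div_le_one_div_of_le (by positivity) ?_
    push_cast
    nlinarith [mul_nonneg hA0 (Nat.cast_nonneg K), mul_nonneg hB0 (Nat.cast_nonneg K)]
  have h1 : Summable fun K : ℕ => 1 / ((1 + A + B) * ((K + 1 : ℕ) : ℝ)) :=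
    Summable.of_nonneg_of_le (fun K => by positivity) hbound h
  have h2 : Summable fun K : ℕ => (1 : ℝ) / ((K + 1 : ℕ) : ℝ) := by
    refine (h1.mul_left (1 + A + B)).congr fun K => ?_
    have hK : (0 : ℝ) < ((K + 1 : ℕ) : ℝ) := by positivity
    field_simp
  exact Real.not_summable_one_div_natCast ((summable_nat_add_iff 1).1 h2)

/-- ★★ **UNIFORM MOMENT MATCHING AT GEOMETRIC CLOSENESS ADMITS LAWS WITH NON-SUMMABLE INCREMENTS**: for every `C > 0`, `0 < θ ≤ 1` there are
probability laws `λ_K` on `[−1,1]` with `|∫x^j dλ_{K+1} − ∫x^j dλ_K| ≤ Cθ^K` for every `j` and continuous `1`-Lipschitz `1`-bounded tests with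
`Σ_K |∫g_K dλ_{K+1} − ∫g_K dλ_K| = ∞` (§1 at the antitone closeness `Cθ^K`, rates not summable by `not_summable_invLogRate_geometric`). [folklore] -/
theorem exists_uniformMoments_geometric_not_summable_lawIncrements {C θ : ℝ} (hC : 0 < C) (hθ0 : 0 < θ) (hθ1 : θ ≤ 1) :
    ∃ Λ : ℕ → Measure ℝ, (∀ K, IsProbabilityMeasure (Λ K)) ∧ (∀ K, Λ K (Set.Icc (-1 : ℝ) 1)ᶜ = 0) ∧
      (∀ K j : ℕ, |∫ x, x ^ j ∂Λ (K + 1) - ∫ x, x ^ j ∂Λ K| ≤ C * θ ^ K) ∧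
      ∃ g : ℕ → ℝ → ℝ, (∀ K, Continuous (g K)) ∧
        (∀ (K : ℕ) (x y : ℝ), x ∈ Set.Icc (-1 : ℝ) 1 → y ∈ Set.Icc (-1 : ℝ) 1 → |g K x - g K y| ≤ 1 * |x - y|) ∧
        (∀ (K : ℕ) (x : ℝ), x ∈ Set.Icc (-1 : ℝ) 1 → |g K x| ≤ 1) ∧
        ¬ Summable (fun K => |∫ x, g K x ∂Λ (K + 1) - ∫ x, g K x ∂Λ K|) :=
  exists_uniformMoments_not_summable_lawIncrements (r := fun K => C * θ ^ K) (fun K => by positivity)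
    (fun K K' h => mul_le_mul_of_nonneg_left (pow_le_pow_of_le_one hθ0.le hθ1 h) hC.le)
    (not_summable_invLogRate_geometric C θ)

/-- ★ **`e^{−(K+1)²}` MEETS THE THRESHOLD**: the rates of `r_K = e^{−(K+1)²}` are summable (`log⁺ r_K⁻¹ = (K+1)²`, minorant `Σ 1∕(K+1)²`); by module 78
every sequence of laws on `[−1,1]` with such uniform moment matching has summable increments. [folklore] -/
theorem summable_invLogRate_expNegSq : Summable fun K : ℕ => 1 / (1 + Real.posLog (Real.exp (-((K : ℝ) + 1) ^ 2))⁻¹) := by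
  have h : ∀ K : ℕ, 1 / (1 + Real.posLog (Real.exp (-((K : ℝ) + 1) ^ 2))⁻¹) ≤ 1 / ((K + 1 : ℕ) : ℝ) ^ 2 := by
    intro K
    rw [← Real.exp_neg, neg_neg, Real.posLog_eq_log (by rw [abs_of_pos (Real.exp_pos _)]; exact Real.one_le_exp (by positivity)),
      Real.log_exp]
    push_cast
    exact one_div_le_one_div_of_le (by positivity) (by linarith)
  refine Summable.of_nonneg_of_le (fun K => (invLogRate_pos _).le) h ?_
  exact (summable_nat_add_iff 1).2 ((Real.summable_one_div_nat_pow (p := 2)).2 one_lt_two)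

end Summit.QuantumFields.YangMills.Theorems.BalabanUVNodesN19UniformMomentSummabilityThresholdSharp

end
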